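import Literature.NumberTheory.Sieve.GreenTao2008
import Literature.NumberTheory.LFunctions.PrimeNumberTheoremProgressions
import HarnessLib

/-!
# Green–Tao (2008): discharge of the Dirichlet-type input `ModifiedVonMangoldtSum`

Sibling PROOFS file of `Literature.NumberTheory.Sieve.GreenTao2008` (D-0014: named facts are
`def X : Prop`; discharges `theorem X_holds : X` live next to them). Of the three named inputs of
the assembly `Literature.NumberTheory.Sieve.exists_prime_arithmetic_progression_of_greenTao` (Theorem 3.5,
Proposition 9.1, and the display on p. 523), this file proves the third:

  `Literature.GreenTao2008.ModifiedVonMangoldtSum_holds : ModifiedVonMangoldtSum`,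

i.e. there is a growth bound `G → ∞` such that for every cutoff `w ≤ G` and all
`0 ≤ κ₁ < κ₂ ≤ 1`, `N⁻¹ ∑_{κ₁ N ≤ n ≤ κ₂ N} Λ̃_{W(N)}(n) → κ₂ - κ₁` (`W(N) = ∏_{p ≤ w(N)} p`),
exactly as Green–Tao use it on p. 524 ("From Dirichlet's theorem we observe that
`∑_{ε_k N ≤ n ≤ 2ε_k N} Λ̃(n) = ε_k N (1 + o(1))`", with `w(N) → ∞` sufficiently slowly, p. 523).

## Proof (the argument Green–Tao allude to on p. 523, made uniform by diagonalisation)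

* For a FIXED modulus `W ≥ 1`: `∑_{n < M} Λ̃_W(n) = (φ(W)/W) θ(WM; W, 1)` (reindex `m = Wn + 1`:
  the `m ≡ 1 (W)` in `[1, WM]` are exactly the `Wn + 1`, `0 ≤ n < M`), and
  `θ(X; W, 1) = X/φ(W) + o_W(X)` is the prime number theorem for the progression `1 mod W`
  (`Literature.NumberTheory.LFunctions.sum_log_prime_residue_isLittleO`, from Wiener–Ikehara and the non-vanishing of
  `L(1 + it, χ)`); hence `∑_{n < M} Λ̃_W(n) = M + o_W(M)` (`sum_range_modifiedVonMangoldt_isLittleO`).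
* Uniformly in `M ≤ N + 1`: `|∑_{n < M} Λ̃_W(n) - M| ≤ ε N` for `N ≥ N₀(W, ε)`
  (`eventually_forall_abs_sub_le_of_isLittleO`; small `M` are absorbed since the partial sums are
  nondecreasing).
* Diagonalisation (`exists_growth_uniform`): if each of countably many conditions `Q_w(ε)` holds
  eventually in `N`, there is `G → ∞` with `Q_w(ε)` for all `w ≤ G(N)` eventually — this is the
  content of "`w(N)` tending to infinity sufficiently slowly".
* Windows: `∑_{⌈κ₁N⌉ ≤ n ≤ ⌊κ₂N⌋} = ∑_{n < ⌊κ₂N⌋+1} - ∑_{n < ⌈κ₁N⌉}` and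
  `|(⌊κ₂N⌋ + 1 - ⌈κ₁N⌉) - (κ₂ - κ₁)N| ≤ 1`.

Only the prime number theorem for each fixed progression `1 mod W` is used — not the
Siegel–Walfisz-strength remark "`w(N) ≪ log log N` will suffice" of p. 523, which the named fact
deliberately does not vendor.

## References

* B. Green, T. Tao, *The primes contain arbitrarily long arithmetic progressions*, Ann. of Math.
  167 (2008), 481–547, §9 pp. 523–524. [cite: GreenTaoAnnals2008]
* H. L. Montgomery, R. C. Vaughan, *Multiplicative Number Theory I*, CUP 2007, Cor. 8.8 and
  Cor. 11.17. [cite: MontgomeryVaughan2007]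
-/

noncomputable section

open Filter Asymptotics Finset
open scoped Topology

namespace Literature.NumberTheory.Sieve.GreenTao2008

/-! ### Reindexing `n ↦ W n + 1` and the cumulative sums of `Λ̃_W` for fixed `W` -/

/-- For `W ≥ 1`, `∑_{n < M} f(W n + 1) = ∑_{1 ≤ m ≤ WM, m ≡ 1 (W)} f(m)`: the integers
`m ≡ 1 (mod W)` in `[1, WM]` are exactly `W n + 1`, `0 ≤ n < M`. [folklore] -/
theorem sum_range_comp_mul_add_one {W : ℕ} (hW : 0 < W) (f : ℕ → ℝ) (M : ℕ) :
    ∑ n ∈ range M, f (W * n + 1) = ∑ m ∈ Icc 1 (W * M) with m % W = 1 % W, f m := by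
  refine Finset.sum_nbij' (fun n => W * n + 1) (fun m => (m - 1) / W) ?_ ?_ ?_ ?_ ?_
  · intro n hn
    rw [mem_range] at hn
    rw [mem_filter, mem_Icc]
    refine ⟨⟨Nat.succ_le_succ (Nat.zero_le _), ?_⟩, by rw [Nat.mul_add_mod]⟩
    calc W * n + 1 ≤ W * n + W := by omega
      _ = W * (n + 1) := by ring
      _ ≤ W * M := Nat.mul_le_mul_left _ hn
  · intro m hm
    rw [mem_filter, mem_Icc] at hm
    rw [mem_range]
    have h1 : m - 1 < W * M := by omega
    exact (Nat.div_lt_iff_lt_mul hW).2 (by rwa [mul_comm] at h1)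
  · intro n _
    simp only [Nat.add_sub_cancel, Nat.mul_div_cancel_left _ hW]
  · intro m hm
    rw [mem_filter, mem_Icc] at hm
    have hdvd : W ∣ m - 1 := Nat.dvd_of_mod_eq_zero (Nat.sub_mod_eq_zero_of_mod_eq hm.2)
    rw [Nat.mul_div_cancel' hdvd]
    omega
  · intro n _
    rfl

/-- `∑_{n < M} Λ̃_W(n) = (φ(W)/W) θ(WM; W, 1)` for `W ≥ 1`, with
`θ(X; W, 1) = ∑_{p ≤ X, p prime, p ≡ 1 (W)} log p`. [cite: GreenTaoAnnals2008, §9 p. 523] -/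
theorem sum_range_modifiedVonMangoldt_eq {W : ℕ} (hW : 0 < W) (M : ℕ) :
    ∑ n ∈ range M, modifiedVonMangoldt W n = (Nat.totient W : ℝ) / W *
      ∑ p ∈ Icc 1 (W * M) with p.Prime ∧ ((p : ℕ) : ZMod W) = 1, Real.log p := by
  unfold modifiedVonMangoldt Literature.NumberTheory.Sieve.vonMangoldtW
  rw [← Finset.mul_sum, sum_range_comp_mul_add_one hW]
  congr 1
  rw [Finset.sum_filter, Finset.sum_filter]
  refine Finset.sum_congr rfl fun m _ => ?_
  have hiff : m % W = 1 % W ↔ ((m : ℕ) : ZMod W) = 1 := by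
    rw [← Nat.cast_one (R := ZMod W), ZMod.natCast_eq_natCast_iff']
  unfold Literature.NumberTheory.Sieve.vonMangoldtPrime
  by_cases h1 : m.Prime <;> by_cases h2 : ((m : ℕ) : ZMod W) = 1 <;> simp [h1, h2, hiff]

/-- For every fixed `W ≥ 1`, `∑_{n < M} Λ̃_W(n) = M + o_W(M)` (`M → ∞`): the prime number theorem
for the progression `1 mod W` (`Literature.NumberTheory.LFunctions.sum_log_prime_residue_isLittleO`) at `X = WM`, times
`φ(W)/W`. This is the fixed-`w` content of the p. 523 display `∑_{n ≤ N} Λ̃(n) = N(1 + o(1))`.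
[cite: GreenTaoAnnals2008, §9 p. 523 (display before Proposition 9.1)] -/
theorem sum_range_modifiedVonMangoldt_isLittleO {W : ℕ} (hW : 0 < W) :
    (fun M : ℕ => ∑ n ∈ range M, modifiedVonMangoldt W n - (M : ℝ)) =o[atTop]
      fun M : ℕ => (M : ℝ) := by
  haveI : NeZero W := ⟨hW.ne'⟩
  have hφ : (0 : ℝ) < Nat.totient W := by exact_mod_cast Nat.totient_pos.2 hW
  have hW' : (0 : ℝ) < W := by exact_mod_cast hW
  have hB := Literature.NumberTheory.LFunctions.sum_log_prime_residue_isLittleO (isUnit_one (M := ZMod W))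
  have hWM : Tendsto (fun M : ℕ => W * M) atTop atTop :=
    tendsto_atTop_mono (fun M => Nat.le_mul_of_pos_left M hW) tendsto_id
  have hO : (fun M : ℕ => (((W * M : ℕ) : ℝ))) =O[atTop] fun M : ℕ => (M : ℝ) := by
    refine IsBigO.of_bound W (Eventually.of_forall fun M => ?_)
    rw [Real.norm_of_nonneg (Nat.cast_nonneg _), Real.norm_of_nonneg (Nat.cast_nonneg _)]
    push_cast
    rfl
  have h := ((hB.comp_tendsto hWM).trans_isBigO hO).const_mul_left ((Nat.totient W : ℝ) / W)
  refine h.congr' (Eventually.of_forall fun M => ?_) EventuallyEq.rfl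
  simp only [Function.comp_def, sum_range_modifiedVonMangoldt_eq hW M]
  push_cast
  field_simp

/-! ### Uniformisation in `M ≤ N + 1` and diagonalisation in `w` -/

/-- If `T` is nondecreasing, nonnegative and `T(M) = M + o(M)`, then for every `ε > 0`,
`|T(M) - M| ≤ ε N` for all `M ≤ N + 1` once `N` is large. [folklore] -/
theorem eventually_forall_abs_sub_le_of_isLittleO {T : ℕ → ℝ} (hT0 : ∀ M, 0 ≤ T M)
    (hmono : Monotone T)
    (h : (fun M : ℕ => T M - (M : ℝ)) =o[atTop] fun M : ℕ => (M : ℝ)) {ε : ℝ} (hε : 0 < ε) :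
    ∀ᶠ N : ℕ in atTop, ∀ M ≤ N + 1, |T M - (M : ℝ)| ≤ ε * N := by
  have h4 : 0 < ε / 4 := by positivity
  obtain ⟨M₀, hM₀⟩ := eventually_atTop.1 (Asymptotics.isLittleO_iff.1 h h4)
  set K : ℝ := T M₀ + M₀ with hK
  have hK0 : 0 ≤ K := add_nonneg (hT0 _) (Nat.cast_nonneg _)
  filter_upwards [eventually_ge_atTop 1, eventually_ge_atTop ⌈K / ε⌉₊] with N hN1 hNK
  intro M hM
  have hN1' : (1 : ℝ) ≤ N := by exact_mod_cast hN1
  rcases le_or_gt M₀ M with hle | hlt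
  · have := hM₀ M hle
    rw [Real.norm_eq_abs, Real.norm_of_nonneg (Nat.cast_nonneg _)] at this
    have hM' : (M : ℝ) ≤ N + 1 := by exact_mod_cast hM
    calc |T M - M| ≤ ε / 4 * M := this
      _ ≤ ε / 4 * (N + 1) := by gcongr
      _ ≤ ε / 4 * (N + N) := by gcongr
      _ = ε / 2 * N := by ring
      _ ≤ ε * N := by nlinarith
  · have hTM : T M ≤ T M₀ := hmono hlt.le
    have hMM : (M : ℝ) ≤ M₀ := by exact_mod_cast hlt.le
    have hKN : K / ε ≤ N := (Nat.ceil_le).1 hNK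
    calc |T M - M| ≤ |T M| + |(M : ℝ)| := abs_sub _ _
      _ = T M + M := by rw [abs_of_nonneg (hT0 M), abs_of_nonneg (Nat.cast_nonneg _)]
      _ ≤ K := by linarith
      _ = K / ε * ε := by field_simp
      _ ≤ N * ε := by gcongr
      _ = ε * N := mul_comm _ _

/-- **Diagonalisation** ("`w(N) → ∞` sufficiently slowly"). Let `Q w ε N` be conditions, monotone
in `ε`, such that for every fixed `w` and `ε > 0`, `Q w ε N` holds for all large `N`. Then there
is a growth bound `G → ∞` such that for every `ε > 0`, for all large `N`, `Q w ε N` holds for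
every `w ≤ G(N)` simultaneously. (Take `N_v` with `Q w (1/(v+1)) N` for `N ≥ N_v`, `w ≤ v`, and
`G(N) = max {v ≤ N : N_v ≤ N}`.) [folklore] -/
theorem exists_growth_uniform {Q : ℕ → ℝ → ℕ → Prop}
    (hmono : ∀ w (ε ε' : ℝ) N, ε ≤ ε' → Q w ε N → Q w ε' N)
    (hQ : ∀ w, ∀ ε : ℝ, 0 < ε → ∀ᶠ N in atTop, Q w ε N) :
    ∃ G : ℕ → ℕ, Tendsto G atTop atTop ∧
      ∀ ε : ℝ, 0 < ε → ∀ᶠ N in atTop, ∀ w ≤ G N, Q w ε N := by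
  have hP : ∀ v : ℕ, ∃ N₀ : ℕ, ∀ N ≥ N₀, ∀ w ≤ v, Q w (1 / (v + 1)) N := by
    intro v
    have hv : (0 : ℝ) < 1 / (v + 1) := by positivity
    have : ∀ᶠ N in atTop, ∀ w ∈ Finset.range (v + 1), Q w (1 / (v + 1)) N :=
      (Filter.eventually_all_finset _).2 fun w _ => hQ w _ hv
    obtain ⟨N₀, h⟩ := eventually_atTop.1 this
    exact ⟨N₀, fun N hN w hw => h N hN w (mem_range.2 (Nat.lt_succ_of_le hw))⟩
  choose Nv hNv using hP
  refine ⟨fun N => Nat.findGreatest (fun v => Nv v ≤ N) N, ?_, ?_⟩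
  · refine tendsto_atTop_atTop.2 fun v => ⟨max v (Nv v), fun N hN => ?_⟩
    exact Nat.le_findGreatest (le_of_max_le_left hN) (le_of_max_le_right hN)
  · intro ε hε
    obtain ⟨v₀, hv₀⟩ := exists_nat_one_div_lt hε
    filter_upwards [eventually_ge_atTop (max v₀ (Nv v₀))] with N hN
    have h1 : v₀ ≤ Nat.findGreatest (fun v => Nv v ≤ N) N :=
      Nat.le_findGreatest (le_of_max_le_left hN) (le_of_max_le_right hN)
    have h2 : Nv (Nat.findGreatest (fun v => Nv v ≤ N) N) ≤ N :=
      Nat.findGreatest_spec (P := fun v => Nv v ≤ N) (le_of_max_le_left hN)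
        (le_of_max_le_right hN)
    intro w hw
    refine hmono w _ _ N ?_ (hNv _ N h2 w hw)
    refine le_trans ?_ hv₀.le
    gcongr

/-! ### The discharge -/

/-- **Discharge of `ModifiedVonMangoldtSum`** (Green–Tao 2008, the display on p. 523 as used on
p. 524): there is a growth bound `G → ∞` such that for every cutoff function `w ≤ G` (the
hypothesis `w → ∞` of the named fact is not even needed) and all `0 ≤ κ₁ < κ₂ ≤ 1`,
`N⁻¹ ∑_{⌈κ₁N⌉ ≤ n ≤ ⌊κ₂N⌋} Λ̃_{W(N)}(n) → κ₂ - κ₁`, `W(N) = ∏_{p ≤ w(N)} p`. Proof: the prime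
number theorem in the progressions `1 mod W` for each fixed `W`
(`sum_range_modifiedVonMangoldt_isLittleO`), uniformised over `M ≤ N + 1` and diagonalised in `w`.
[cite: GreenTaoAnnals2008, §9 p. 523 (display before Proposition 9.1) and p. 524] -/
theorem ModifiedVonMangoldtSum_holds : ModifiedVonMangoldtSum := by
  have step : ∀ w : ℕ, ∀ ε : ℝ, 0 < ε → ∀ᶠ N : ℕ in atTop, ∀ M ≤ N + 1,
      |∑ n ∈ range M, modifiedVonMangoldt (primorial w) n - (M : ℝ)| ≤ ε * N := fun w ε hε =>
    eventually_forall_abs_sub_le_of_isLittleO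
      (T := fun M : ℕ => ∑ n ∈ range M, modifiedVonMangoldt (primorial w) n)
      (fun M => Finset.sum_nonneg fun n _ => modifiedVonMangoldt_nonneg _ _)
      (fun M M' h => Finset.sum_le_sum_of_subset_of_nonneg (range_mono h)
        fun n _ _ => modifiedVonMangoldt_nonneg _ _)
      (sum_range_modifiedVonMangoldt_isLittleO (primorial_pos w)) hε
  obtain ⟨G, hG, hG'⟩ := exists_growth_uniform
    (Q := fun w ε N => ∀ M ≤ N + 1,
      |∑ n ∈ range M, modifiedVonMangoldt (primorial w) n - (M : ℝ)| ≤ ε * N)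
    (fun w ε ε' N h hq M hM => (hq M hM).trans (by gcongr)) step
  refine ⟨G, hG, fun w _ hwG κ₁ κ₂ h0 hlt h1 => ?_⟩
  rw [Metric.tendsto_atTop]
  intro ε hε
  obtain ⟨N₀, hN₀⟩ := eventually_atTop.1
    ((hG' (ε / 4) (by positivity)).and (eventually_gt_atTop ⌈4 / ε⌉₊))
  refine ⟨N₀, fun N hN => ?_⟩
  obtain ⟨hQ, hN4⟩ := hN₀ N hN
  have hN4' : 4 / ε < N := (Nat.le_ceil _).trans_lt (by exact_mod_cast hN4)
  have hN0 : (0 : ℝ) < N := lt_trans (by positivity) hN4'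
  have hNinv : (N : ℝ)⁻¹ < ε / 4 := by
    rw [div_lt_iff₀ hε] at hN4'
    rw [inv_eq_one_div, div_lt_div_iff₀ hN0 (by norm_num : (0 : ℝ) < 4)]
    linarith
  replace hQ := hQ (w N) (hwG N)
  set W := primorial (w N) with hW
  set T : ℕ → ℝ := fun M => ∑ n ∈ range M, modifiedVonMangoldt W n with hT
  set A := ⌈κ₁ * N⌉₊ with hA
  set B := ⌊κ₂ * N⌋₊ with hB
  have hκN : κ₁ * N ≤ κ₂ * N := by gcongr
  have hAB : A ≤ B + 1 := (Nat.ceil_mono hκN).trans (Nat.ceil_le_floor_add_one _)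
  have hB1 : B + 1 ≤ N + 1 := by
    gcongr
    refine Nat.floor_le_of_le ?_
    calc κ₂ * N ≤ 1 * N := by gcongr
      _ = N := one_mul _
  have hA1 : A ≤ N + 1 := hAB.trans hB1
  -- the window sum as a difference of two cumulative sums
  have hwindow : ∑ n ∈ Icc A B, modifiedVonMangoldt W n = T (B + 1) - T A := by
    show ∑ n ∈ Icc A B, modifiedVonMangoldt W n =
      ∑ n ∈ range (B + 1), modifiedVonMangoldt W n - ∑ n ∈ range A, modifiedVonMangoldt W n
    rw [eq_sub_iff_add_eq', ← Finset.Ico_add_one_right_eq_Icc]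
    exact Finset.sum_range_add_sum_Ico _ hAB
  have hQA := hQ A hA1
  have hQB := hQ (B + 1) hB1
  -- the counting term `|(B + 1 - A) - (κ₂ - κ₁) N| ≤ 1`
  have hcount : |((B + 1 : ℕ) : ℝ) - A - (κ₂ - κ₁) * N| ≤ 1 := by
    have hκ₂ : 0 ≤ κ₂ := h0.trans hlt.le
    have h1 : (B : ℝ) ≤ κ₂ * N := Nat.floor_le (mul_nonneg hκ₂ (Nat.cast_nonneg _))
    have h2 : κ₂ * N < B + 1 := Nat.lt_floor_add_one _
    have h3 : κ₁ * N ≤ A := Nat.le_ceil _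
    have h4 : (A : ℝ) < κ₁ * N + 1 := Nat.ceil_lt_add_one (mul_nonneg h0 (Nat.cast_nonneg _))
    rw [abs_le]
    push_cast
    constructor <;> linarith
  rw [Real.dist_eq, hwindow]
  have hsplit : (N : ℝ)⁻¹ * (T (B + 1) - T A) - (κ₂ - κ₁) =
      (N : ℝ)⁻¹ * ((T (B + 1) - ((B + 1 : ℕ) : ℝ)) - (T A - A) +
        ((((B + 1 : ℕ) : ℝ) - A) - (κ₂ - κ₁) * N)) := by
    field_simp
    ring
  rw [hsplit, abs_mul, abs_of_pos (inv_pos.2 hN0)]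
  calc (N : ℝ)⁻¹ * |T (B + 1) - ((B + 1 : ℕ) : ℝ) - (T A - A) +
        (((B + 1 : ℕ) : ℝ) - A - (κ₂ - κ₁) * N)|
      ≤ (N : ℝ)⁻¹ * (|T (B + 1) - ((B + 1 : ℕ) : ℝ)| + |T A - A| +
        |((B + 1 : ℕ) : ℝ) - A - (κ₂ - κ₁) * N|) := by
        gcongr
        exact (abs_add_le _ _).trans (add_le_add (abs_sub _ _) le_rfl)
    _ ≤ (N : ℝ)⁻¹ * (ε / 4 * N + ε / 4 * N + 1) := by gcongr
    _ = ε / 2 + (N : ℝ)⁻¹ := by field_simp; ring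
    _ < ε / 2 + ε / 4 := by gcongr
    _ < ε := by linarith

end Literature.NumberTheory.Sieve.GreenTao2008

end
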